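import Literature.Computability.Cryptography.HallgrenClassGroupOrder
import HarnessLib

/-!
# Hallgren 2005 / class numbers under GRH — step Q1d (ii): reduced forms with the same class in
# `Cl(O_D)` are equal (Cox, Thm. 7.7(ii) for orders), and the finite group of reduced classes

Topic `Literature/Computability/Cryptography`; proof companion of `HallgrenClassGroup.lean`
(named fact `Hallgren2005_classNumber_qsolvable_of_GRH`). Real definitions and theorems; no named
fact. Sequel of `HallgrenClassGroupOrder.lean` (`classOf' Δ f ∈ Cl(O_D)` for every `D < 0`).

* the `ℤ`-structure of a form ideal: `bvec f u v = u a − v (ω − k)`, `exists_bvec_of_mem`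
  (`𝔞_f = ℤ a ⊕ ℤ (ω − k)`), `norm_bvec` (`N(u a − v(ω − k)) = a · f(u, v)`), the `2 × 2`
  determinant `det2` with `det2_mul_left` (`det(x v, x w) = N(x) det(v, w)`) and `det2_comb`;
* **`eq_of_span_mul_fIdeal_eq`**: if `x 𝔞_f = y 𝔞_g` (`x, y ≠ 0`) for primitive positive definite
  `f, g` then `f ∼ g` properly — the two oriented bases `x(a, −θ_f)`, `y(a', −θ_g)` of the common
  lattice differ by an integer matrix of determinant `±1`, the determinants `−a N(x)`, `−a' N(y)`
  force `+1` and `a N(x) = a' N(y)`, and the norm forms give `f(u, v) = g(pu + qv, ru + sv)` — hence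
  **`classOf'_inj`**: reduced forms with the same class coincide (Cox Thm. 7.7(ii) with Thm. 2.8);
* `redClasses Δ` — the subgroup of `Cl(O_D)` of classes of reduced primitive positive definite
  forms (closed under products by `classOf'_compose`, inverses by `classOf'_reduce_negForm`) — and
  its finiteness `finite_redClasses` (an image of `reducedForms D`).

## References

* D. A. Cox, *Primes of the form x² + ny²*, 2nd ed. (2013), §7.B Thm. 7.7 (proof, (7.8)–(7.16)),
  §2.A Thm. 2.8 [Cox2013].
* A. M. Childs, W. van Dam, Rev. Mod. Phys. 82 (2010), §5.7 [ChildsVandam2010].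
-/

noncomputable section

open scoped nonZeroDivisors QuadraticAlgebra

namespace Literature.Computability.Cryptography.Hallgren2005

namespace OrderCl

open Module QuadraticAlgebra
open Literature.NumberTheory.QuadraticFields.Quadratic Literature.NumberTheory.QuadraticFields.Quadratic.BinQF
open Literature.NumberTheory.QuadraticFields.BinaryQuadraticForm (reducedForms mem_reducedForms_iff isReduced_iff
  mem_reducedForms_of_isPosPrim_of_isReduced)
open FormComposition Composition Reduction

variable (Δ : NegDiscr)

/-! ### The `ℤ`-structure of a form ideal -/

/-- `u a − v (ω − k(f))`: the coordinates of `𝔞_f` in its basis `(a, −(ω − k))`. [cite: Cox2013, §7.B (7.8) (the lattice [a, aτ])] -/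
def bvec (f : BinQF) (u v : ℤ) : QO Δ :=
  (u : QO Δ) * (f.a : QO Δ) + (v : QO Δ) * ((kOf Δ.D f : QO Δ) - ω)

/-- Real part of `bvec`. [folklore] -/
@[simp] theorem bvec_re (f : BinQF) (u v : ℤ) : (bvec Δ f u v).re = u * f.a + v * kOf Δ.D f := by
  simp [bvec, omega]

/-- Imaginary part of `bvec`. [folklore] -/
@[simp] theorem bvec_im (f : BinQF) (u v : ℤ) : (bvec Δ f u v).im = -v := by
  simp [bvec, omega]

/-- `bvec` is additive. [folklore] -/
theorem bvec_add (f : BinQF) (u v u' v' : ℤ) :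
    bvec Δ f (u + u') (v + v') = bvec Δ f u v + bvec Δ f u' v' := by
  simp only [bvec]; push_cast; ring

/-- `bvec` is `ℤ`-bilinear: `bvec (pu + qv) (ru + sv) = u bvec p r + v bvec q s`. [folklore] -/
theorem bvec_comb (f : BinQF) (p q r s u v : ℤ) :
    bvec Δ f (p * u + q * v) (r * u + s * v) = (u : QO Δ) * bvec Δ f p r + (v : QO Δ) * bvec Δ f q s := by
  simp only [bvec]; push_cast; ring

/-- `bvec` is injective (`a ≠ 0`). [folklore] -/
theorem bvec_inj {f : BinQF} (ha : f.a ≠ 0) {u v u' v' : ℤ} (h : bvec Δ f u v = bvec Δ f u' v') :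
    u = u' ∧ v = v' := by
  have h1 := congrArg QuadraticAlgebra.im h
  have h2 := congrArg QuadraticAlgebra.re h
  simp only [bvec_im, bvec_re, neg_inj] at h1 h2
  subst h1
  refine ⟨?_, rfl⟩
  have : (u - u') * f.a = 0 := by linarith
  rcases mul_eq_zero.1 this with h | h
  · linarith
  · exact absurd h ha

/-- `bvec u v ∈ 𝔞_f`. [folklore] -/
theorem bvec_mem (f : BinQF) (u v : ℤ) : bvec Δ f u v ∈ fIdeal Δ f := by
  rw [bvec, fIdeal, show (v : QO Δ) * ((kOf Δ.D f : QO Δ) - ω) = (-(v : QO Δ)) * (ω - (kOf Δ.D f : QO Δ)) by ring]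
  exact Ideal.add_mem _ (Ideal.mul_mem_left _ _ (Ideal.subset_span (by simp)))
    (Ideal.mul_mem_left _ _ (Ideal.subset_span (by simp)))

variable {Δ}

/-- `ω · bvec u v` is again of the form `bvec`: `ω a = k a + a θ`, `ω θ = (k − b) θ − c a`. [folklore] -/
theorem omega_mul_bvec {f : BinQF} (hf : f.IsPosPrim Δ.D) (u v : ℤ) :
    (ω : QO Δ) * bvec Δ f u v = bvec Δ f (u * kOf Δ.D f + v * f.c) (-(u * f.a) - v * (f.b - kOf Δ.D f)) := by
  have hn := norm_eq hf.disc_eq hf.emod_four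
  have hb := b_eq_two_mul_kOf_sub hf.disc_eq (D := Δ.D)
  apply QuadraticAlgebra.ext
  · simp only [bvec_re, re_mul, omega_re, omega_im, bvec_im]
    linear_combination (-(v : ℤ)) * hn + (v * kOf Δ.D f) * hb
  · simp only [bvec_im, im_mul, omega_re, omega_im, bvec_re]
    linear_combination (-(v : ℤ)) * hb

/-- **`𝔞_f = ℤ a ⊕ ℤ (ω − k)`**: every element of the form ideal has integer coordinates.
[cite: Cox2013, §7.B (7.8)] -/
theorem exists_bvec_of_mem {f : BinQF} (hf : f.IsPosPrim Δ.D) {z : QO Δ} (hz : z ∈ fIdeal Δ f) :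
    ∃ u v : ℤ, z = bvec Δ f u v := by
  rw [fIdeal] at hz
  refine Submodule.span_induction ?_ ?_ ?_ ?_ hz
  · intro w hw
    simp only [Set.mem_insert_iff, Set.mem_singleton_iff] at hw
    rcases hw with rfl | rfl
    · exact ⟨1, 0, by simp [bvec]⟩
    · exact ⟨0, -1, by simp [bvec]⟩
  · exact ⟨0, 0, by simp [bvec]⟩
  · rintro w w' - - ⟨u, v, rfl⟩ ⟨u', v', rfl⟩
    exact ⟨u + u', v + v', (bvec_add Δ f u v u' v').symm⟩
  · rintro r w - ⟨u, v, rfl⟩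
    rw [smul_eq_mul, show r = (r.re : QO Δ) + (r.im : QO Δ) * ω by ext <;> simp [omega], add_mul,
      mul_assoc, omega_mul_bvec hf]
    refine ⟨r.re * u + r.im * (u * kOf Δ.D f + v * f.c), r.re * v + r.im * (-(u * f.a) - v * (f.b - kOf Δ.D f)), ?_⟩
    simp only [bvec]; push_cast; ring

/-- **The norm form of the ideal basis**: `N(u a − v(ω − k)) = a · f(u, v)`. [cite: Cox2013, §7.B (7.16)] -/
theorem norm_bvec {f : BinQF} (hf : f.IsPosPrim Δ.D) (u v : ℤ) : (bvec Δ f u v).norm = f.a * f.eval u v := by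
  have hn := norm_eq hf.disc_eq hf.emod_four
  have hb := b_eq_two_mul_kOf_sub hf.disc_eq (D := Δ.D)
  rw [norm_def, bvec_re, bvec_im, BinQF.eval, hb]
  nlinarith [hn]

/-! ### Determinants -/

variable (Δ)

/-- The `2 × 2` determinant of two elements of `O_D` in the basis `(1, ω)`. [folklore] -/
def det2 (v w : QO Δ) : ℤ := v.re * w.im - v.im * w.re

/-- **`det(x v, x w) = N(x) det(v, w)`.** [folklore] -/
theorem det2_mul_left (x v w : QO Δ) : det2 Δ (x * v) (x * w) = x.norm * det2 Δ v w := by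
  simp only [det2, re_mul, im_mul, norm_def]; ring

/-- Change of basis multiplies the determinant by `ps − qr`. [folklore] -/
theorem det2_comb (p q r s : ℤ) (v w : QO Δ) :
    det2 Δ ((p : QO Δ) * v + (r : QO Δ) * w) ((q : QO Δ) * v + (s : QO Δ) * w) = (p * s - q * r) * det2 Δ v w := by
  simp only [det2, re_add, im_add, re_mul, im_mul, re_intCast, im_intCast, Int.cast_id]; ring

/-- The basis `(a, −(ω − k))` of `𝔞_f` has determinant `−a`. [folklore] -/
theorem det2_bvec (f : BinQF) : det2 Δ (bvec Δ f 1 0) (bvec Δ f 0 1) = -f.a := by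
  simp [det2]

variable {Δ}

/-! ### Equal classes of reduced forms -/

/-- Coordinates along a principal multiple: the elements `x · bvec_f u v` of `x 𝔞_f = y 𝔞_g` have
`g`-coordinates. [folklore] -/
theorem exists_coords {f g : BinQF} (hg : g.IsPosPrim Δ.D) {x y : QO Δ}
    (h : Ideal.span {x} * fIdeal Δ f = Ideal.span {y} * fIdeal Δ g) (u v : ℤ) :
    ∃ u' v' : ℤ, x * bvec Δ f u v = y * bvec Δ g u' v' := by
  have hmem : x * bvec Δ f u v ∈ Ideal.span {y} * fIdeal Δ g := by
    rw [← h]; exact Ideal.mul_mem_mul (Ideal.mem_span_singleton_self x) (bvec_mem Δ f u v)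
  obtain ⟨z, hz, hzeq⟩ := Ideal.mem_span_singleton_mul.1 hmem
  obtain ⟨u', v', rfl⟩ := exists_bvec_of_mem hg hz
  exact ⟨u', v', hzeq.symm⟩

/-- A form is determined by its values at `(1,0), (0,1), (1,1)`; here: equal value functions after
a substitution give `act`. [folklore] -/
theorem eq_act_of_eval_eq {f g : BinQF} {p q r s : ℤ}
    (h : ∀ u v, f.eval u v = g.eval (p * u + q * v) (r * u + s * v)) : f = g.act p q r s := by
  have h10 := h 1 0
  have h01 := h 0 1
  have h11 := h 1 1
  simp only [BinQF.eval, mul_one, mul_zero, add_zero, zero_add, one_pow, mul_one] at h10 h01 h11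
  ext <;> simp only [BinQF.act] <;> nlinarith [h10, h01, h11]

/-- **`x 𝔞_f = y 𝔞_g` implies `f ∼ g`** for primitive positive definite forms (Cox, proof of
Thm. 7.7(ii), in the language of lattices: oriented bases of one lattice, determinant and norm
comparison). [cite: Cox2013, §7.B Thm. 7.7(ii) (proof)] -/
theorem properEquiv_of_span_mul_fIdeal_eq {f g : BinQF} (hf : f.IsPosPrim Δ.D) (hg : g.IsPosPrim Δ.D)
    {x y : QO Δ} (hx : x ≠ 0) (hy : y ≠ 0)
    (h : Ideal.span {x} * fIdeal Δ f = Ideal.span {y} * fIdeal Δ g) : g.ProperEquiv f := by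
  have ha := hf.a_pos
  have ha' := hg.a_pos
  -- coordinates of the `f`-basis in the `g`-basis and conversely
  obtain ⟨p, r, hpr⟩ := exists_coords hg h 1 0
  obtain ⟨q, s, hqs⟩ := exists_coords hg h 0 1
  obtain ⟨p', r', hpr'⟩ := exists_coords hf h.symm 1 0
  obtain ⟨q', s', hqs'⟩ := exists_coords hf h.symm 0 1
  -- linearity: `x bvec_f u v = y bvec_g (pu + qv) (ru + sv)`
  have hlin : ∀ u v : ℤ, x * bvec Δ f u v = y * bvec Δ g (p * u + q * v) (r * u + s * v) := by
    intro u v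
    have : bvec Δ f u v = (u : QO Δ) * bvec Δ f 1 0 + (v : QO Δ) * bvec Δ f 0 1 := by
      rw [← bvec_comb]; simp
    rw [this, mul_add, mul_left_comm, hpr, mul_left_comm x, hqs, bvec_comb]; ring
  have hlin' : ∀ u v : ℤ, y * bvec Δ g u v = x * bvec Δ f (p' * u + q' * v) (r' * u + s' * v) := by
    intro u v
    have : bvec Δ g u v = (u : QO Δ) * bvec Δ g 1 0 + (v : QO Δ) * bvec Δ g 0 1 := by
      rw [← bvec_comb]; simp
    rw [this, mul_add, mul_left_comm, hpr', mul_left_comm y, hqs', bvec_comb]; ring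
  -- the matrices are mutually inverse, so `det = ±1`
  have hcomp : ∀ u v : ℤ, bvec Δ f u v =
      bvec Δ f (p' * (p * u + q * v) + q' * (r * u + s * v)) (r' * (p * u + q * v) + s' * (r * u + s * v)) := by
    intro u v
    have := hlin u v
    rw [hlin'] at this
    exact mul_left_cancel₀ hx this
  have h1 := bvec_inj Δ ha.ne' (hcomp 1 0)
  have h2 := bvec_inj Δ ha.ne' (hcomp 0 1)
  simp only [mul_one, mul_zero, add_zero, zero_add] at h1 h2
  have hdet1 : (p * s - q * r) * (p' * s' - q' * r') = 1 := by nlinarith [h1.1, h1.2, h2.1, h2.2]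
  -- determinants: `−a N(x) = (ps − qr) · (−a' N(y))`
  have hdetx : det2 Δ (x * bvec Δ f 1 0) (x * bvec Δ f 0 1) = x.norm * (-f.a) := by
    rw [det2_mul_left, det2_bvec]
  have hdety : det2 Δ (x * bvec Δ f 1 0) (x * bvec Δ f 0 1) = y.norm * ((p * s - q * r) * (-g.a)) := by
    rw [hpr, hqs]
    have e1 : bvec Δ g p r = (p : QO Δ) * bvec Δ g 1 0 + (r : QO Δ) * bvec Δ g 0 1 := by
      rw [← bvec_comb]; simp
    have e2 : bvec Δ g q s = (q : QO Δ) * bvec Δ g 1 0 + (s : QO Δ) * bvec Δ g 0 1 := by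
      rw [← bvec_comb]; simp
    rw [det2_mul_left, e1, e2, det2_comb, det2_bvec]
  have hNx := norm_pos Δ hx
  have hNy := norm_pos Δ hy
  have hdet : p * s - q * r = 1 := by
    rcases Int.eq_one_or_neg_one_of_mul_eq_one hdet1 with h1 | h1
    · exact h1
    · exfalso
      rw [hdetx, h1] at hdety
      nlinarith
  have hscale : x.norm * f.a = y.norm * g.a := by
    rw [hdetx, hdet] at hdety
    nlinarith
  -- norms: `N(x) a f(u,v) = N(y) a' g(pu+qv, ru+sv)`
  have heval : ∀ u v : ℤ, f.eval u v = g.eval (p * u + q * v) (r * u + s * v) := by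
    intro u v
    have := congrArg QuadraticAlgebra.norm (hlin u v)
    rw [map_mul, map_mul, norm_bvec hf, norm_bvec hg, ← mul_assoc, ← mul_assoc, hscale] at this
    have hne : y.norm * g.a ≠ 0 := mul_ne_zero hNy.ne' ha'.ne'
    exact mul_left_cancel₀ hne this
  exact ⟨p, q, r, s, hdet, eq_act_of_eval_eq heval⟩

variable (Δ)

/-- **Reduced forms with the same class in `Cl(O_D)` are equal** (Cox Thm. 7.7(ii) for the order
`O_D`, with the uniqueness of reduced forms, Thm. 2.8). [cite: Cox2013, §7.B Thm. 7.7(ii) and §2.A Thm. 2.8] -/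
theorem classOf'_inj {f g : BinQF} (hf : f.IsPosPrim Δ.D) (hg : g.IsPosPrim Δ.D) (hfr : f.IsReduced)
    (hgr : g.IsReduced) (h : classOf' Δ f = classOf' Δ g) : f = g := by
  obtain ⟨x, y, hx, hy, hxy⟩ := (classOf'_eq_classOf'_iff Δ hf hg).1 h
  exact (BinQF.eq_of_properEquiv_of_isReduced hg hf hgr hfr (properEquiv_of_span_mul_fIdeal_eq hf hg hx hy hxy)).symm

/-- `reduce f = reduce g` iff the classes agree (a complete invariant computed by the algorithm).
[cite: Cox2013, §7.B Thm. 7.7(ii) and §2.A Thm. 2.8] -/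
theorem reduce_eq_reduce_iff {f g : BinQF} (hf : f.IsPosPrim Δ.D) (hg : g.IsPosPrim Δ.D) :
    reduce f = reduce g ↔ classOf' Δ f = classOf' Δ g := by
  constructor
  · intro h
    rw [← classOf'_reduce Δ hf, ← classOf'_reduce Δ hg, h]
  · intro h
    exact classOf'_inj Δ (isPosPrim_reduce Δ.neg hf) (isPosPrim_reduce Δ.neg hg) (isReduced_reduce Δ.neg hf)
      (isReduced_reduce Δ.neg hg) (by rwa [classOf'_reduce Δ hf, classOf'_reduce Δ hg])

/-! ### The finite group of classes of reduced forms -/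

/-- The classes of the reduced primitive positive definite forms of discriminant `D` (with `1`),
a subgroup of `Cl(O_D)`: the FORM CLASS GROUP of discriminant `D` realised inside `Cl(O_D)`.
[cite: Cox2013, §7.B Thm. 7.7 and §3.A Thm. 3.9] -/
def redClasses : Subgroup (ClassGroup (QO Δ)) where
  carrier := {c | c = 1 ∨ ∃ f : BinQF, f.IsPosPrim Δ.D ∧ f.IsReduced ∧ classOf' Δ f = c}
  one_mem' := Or.inl rfl
  mul_mem' := by
    rintro c c' (rfl | ⟨f, hf, hfr, rfl⟩) (rfl | ⟨g, hg, hgr, rfl⟩)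
    · exact Or.inl (one_mul _)
    · exact Or.inr ⟨g, hg, hgr, (one_mul _).symm⟩
    · exact Or.inr ⟨f, hf, hfr, (mul_one _).symm⟩
    · exact Or.inr ⟨compose Δ.D f g, isPosPrim_compose' Δ hf hg, isReduced_compose' Δ hf hg,
        classOf'_compose Δ hf hg⟩
  inv_mem' := by
    rintro c (rfl | ⟨f, hf, hfr, rfl⟩)
    · exact Or.inl inv_one
    · refine Or.inr ⟨reduce (negForm f), isPosPrim_reduce Δ.neg (isPosPrim_negForm hf),
        isReduced_reduce Δ.neg (isPosPrim_negForm hf), ?_⟩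
      exact (eq_inv_of_mul_eq_one_right (classOf'_reduce_negForm Δ hf))

/-- Membership in `redClasses`. [folklore] -/
theorem mem_redClasses {c : ClassGroup (QO Δ)} :
    c ∈ redClasses Δ ↔ c = 1 ∨ ∃ f : BinQF, f.IsPosPrim Δ.D ∧ f.IsReduced ∧ classOf' Δ f = c := Iff.rfl

/-- The class of a primitive positive definite form lies in `redClasses`. [folklore] -/
theorem classOf'_mem_redClasses {f : BinQF} (hf : f.IsPosPrim Δ.D) : classOf' Δ f ∈ redClasses Δ :=
  Or.inr ⟨reduce f, isPosPrim_reduce Δ.neg hf, isReduced_reduce Δ.neg hf, classOf'_reduce Δ hf⟩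

/-- **`redClasses` is finite** (an image of the finite set `reducedForms D`, plus `1`). [cite: Cox2013, §2.A Thm. 2.13] -/
theorem finite_redClasses : Set.Finite (redClasses Δ : Set (ClassGroup (QO Δ))) := by
  have hfin : Set.Finite ((fun Q : ℤ × ℤ × ℤ => classOf' Δ ⟨Q.1, Q.2.1, Q.2.2⟩) '' (reducedForms Δ.D : Set (ℤ × ℤ × ℤ))) :=
    (reducedForms Δ.D).finite_toSet.image _
  refine (hfin.insert 1).subset ?_
  rintro c (rfl | ⟨f, hf, hfr, rfl⟩)
  · exact Set.mem_insert _ _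
  · refine Set.mem_insert_of_mem _ ⟨(f.a, f.b, f.c), ?_, rfl⟩
    exact mem_reducedForms_of_isPosPrim_of_isReduced Δ.neg hf hfr

/-- `redClasses` as a finite type. [folklore] -/
instance : Finite (redClasses Δ) := (finite_redClasses Δ).to_subtype

end OrderCl

end Literature.Computability.Cryptography.Hallgren2005

end
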